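/-
Copyright: lit-balaban cell, Phase-2 proof seat p11 (gen 4).  Statement-level skeleton of a published paper; no proof claims beyond
what the kernel checks below.
-/
import Literature.MathematicalPhysics.QuantumFieldTheory.BalabanImbrieJaffe1984to88.BIJ85ScalarPropagatorTorusK
import Literature.MathematicalPhysics.QuantumFieldTheory.BalabanImbrieJaffe1984to88.BIJ85Sect7Statements
import Literature.MathematicalPhysics.QuantumFieldTheory.BalabanImbrieJaffe1984to88.BIJ85CoefficientAk464
import Literature.MathematicalPhysics.QuantumFieldTheory.BalabanImbrieJaffe1984to88.BIJ85BlockAveragingIneq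

/-!
# `BalabanImbrieJaffe1984to88.BIJ85Ineq732Flat` — T. Bałaban, J. Imbrie, A. Jaffe, *Renormalization of the Higgs model:
minimizers, propagators and the stability of mean field theory*, Commun. Math. Phys. **97** (1985) 299–329
[BalabanImbrieJaffe1985]: Sect. 7.3 p. 326 **the scalar stability estimate (7.3.2) PROVED AT THE FLAT BACKGROUND `u_k = 1`
(and at every pure-gauge background) on the torus model of record, every level `k`, every torus, with an explicit constant
`γ = min(a_k/(8d), ½)` uniform in `k` and in the volume, and NO negative mass term (`M = 0`)**; r15's typed claim
`BIJ85Sect7Statements.ScalarStabData.Claim73` INHABITED for the family of all flat-background data.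

statement-level skeleton of published theorems with citation tags; proofs where landed; nothing here is a claim about the Yang–Mills mass gap

PDF held: `paper:balaban1985-cmp97-bij-higgs-minimizers` (journal page = PDF page + 298).  Pages read this session (`lit read`, OCR
text + the b2b renders `renders/bij1985/…-p026-x2.png`): p. 308 [PDF 10], p. 313 [PDF 15], p. 318–321 [PDF 20–23], p. 324–326 [PDF 26–28].

CITATION HEADER (lean-in-tree rule).  Phase-2 file of the lit-balaban TYPED SKELETON (HOME `run/shared/lean/pub/lit-balaban/`), seat
p11 gen 4 (unit `lit-balaban-p11-g4`; TAKING line HOME/STATUS.md 2026-08-21T06:04:48Z; owner r15, referee ref-5; free-target protocol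
G.5-34(d), own lane = the C1 scalar sector §§4.6/7.3 of gens 2–3: `BIJ85ScalarForm464` p248398, `BIJ85ScalarPropagatorTorus(K)`
p248857/p249871, `BIJ85BlockAveragesTorusK` p249589/p249947).  WHAT IS REPRODUCED = SKELETON row **C1.Eq7.3.1-7.3.2** (`typed p239582`,
r15: *"NO printed proof — 'extension of the proofs of [7]' = B4"*), as a PROVED MEMBER (kind «model-instance», partial: flat and
pure-gauge backgrounds).  Consumer on record: [BalabanImbrieJaffe1988] (2.38) takes (I.7.3.2) as a hypothesis (`BIJ88Ineq238Proof`, p02).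

THE PRINTED TEXT, verbatim (p. 326 [PDF 28]): *"7.3. Positivity of Δ_k(u_k).  The scalar field quadratic form Δ_k(u_k) depends on the
background field u_k. Hence we can only establish stability properties for Δ_k(u_k) with some restriction on u_k. In particular, let
us assume that for the unit lattice field v, |v(∂p) − 1| ≤ e_k𝓅(e_k), (7.3.1) where 𝓅(e_k) = (1 + ln e_k^{−1})^𝓅. Then the stability
estimate can be stated in two forms. For constants γ > 0, α > 0, M < ∞,
⟨φ, Δ_k(u_k)φ⟩ ≥ γ Σ_{b∈T₁^{(k)}} |u_k(b)φ(b₊) − φ(b₋)|² − Me_k^{2−α} Σ_{x∈T₁^{(k)}} |φ(x)|². (7.3.2)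
The second form of the inequality substitutes v_b for u_k(b) in the covariant derivative of φ. These inequalities can be proved by an
extension of the proofs of [7]."*  ([7] = [Balaban1983RegularityDecay] = B4, its «Proposition 3.1′ of [2]» (1.21)–(1.22) p. 574.)
p. 313 [PDF 15]: *"G_k(u_k) = [−Δ_{u_k} + a_kQ_k^*(u_k)Q_k(u_k)]^{−1}, (4.6.2) … a_k = a(1 − L^{−2})(1 − L^{−2k})^{−1} in the k-step
transformation [3]. The quadratic form which arises for the scalar field is ⟨ψ, Δ_k(u_k)ψ⟩, where ψ is the unit lattice scalar field
and where Δ_k(u_k) = a_kI − a_k²Q_k(u_k)G_k(u_k)Q_k^*(u_k). (4.6.4) … ψ_k = a_kG_k(u_k)Q_k^*(u_k)ψ."*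

WHAT IS PROVED HERE (0 `sorry`, axioms `propext`/`Classical.choice`/`Quot.sound`).  Carriers of record only: the `η`-lattice = the torus
`Balaban1983to89.Site P j`, the unit lattice `T₁^{(k)}` = `Site P (j+k)` (standing range `j + k ≤ m + K`), `U(1)` fields
`GaugeField P j U1` read in `ℂ` by `toC`, the `ℓ²` spaces `FineSp`/`CoarseSpK` and the linear maps `Dlin c u` (`(D_uφ)_b = c(u_bφ(b₊) − φ(b₋))`,
`c` the normalization of the `η`-lattice kinetic term), `QlinK u k` (= `Q_k(u)`, the `k`-fold composition of (2.6), `qCovK`) of gens 2–3,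
and `Δ_k(u) = BIJ85ScalarForm464.deltaOp (QlinK u k) a G` with `G = G_k(u)` any right inverse of `D^*D + aQ_k^*Q_k` (it EXISTS for every
`u`: `BIJ85ScalarPropagatorTorusK.exists_GK`).
* §1 `bondForm W ψ = Σ_{b∈T₁^{(k)}} |W(b)ψ(b₊) − ψ(b₋)|²` — the right-hand sum of (7.3.2) at a unit-lattice bond field `W` (= `u_k(b)`,
  first form, or `v_b`, second form); `E(ψ₁+ψ₂) ≤ 2E(ψ₁) + 2E(ψ₂)`, `E(χ) ≤ 4d‖χ‖²` (each site lies in `2d` bonds, `|W| = 1`).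
* §2 from file 1/2 `BIJ85BlockAveragingIneq` (theorems only): THE BLOCK-AVERAGING INEQUALITY `Σ_{⟨y,y+e_μ⟩}|(Q_k(1)φ)(y+e_μ) −
  (Q_k(1)φ)(y)|² ≤ (n²/N)Σ_b|φ(b₊) − φ(b₋)|²` (`n = L^k`, `N = L^{kd}`), the value `⟨ψ, Δ_kψ⟩ = a_k‖Q_kφ_k − ψ‖² + ‖Dφ_k‖²` at the minimizer
  (with `0 ≤ ⟨ψ, Δ_k(u)ψ⟩ ≤ a_k‖ψ‖²` for EVERY `u`) and `a_k ≥ 8a/9`; here `‖D₁φ‖² = c²Σ_b|φ(b₊) − φ(b₋)|²`, `bondForm_qlinK_one_le`.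
* §3 **`ineq732_flat`**: for every torus, every `k` with `j + k ≤ m + K`, `a > 0`, `c ≠ 0`, every `ψ : T₁^{(k)} → ℂ`,
  `min(a/(8d), Nc²/(2n²))·Σ_{b∈T₁^{(k)}}|ψ(b₊) − ψ(b₋)|² ≤ ⟨ψ, Δ_k(1)ψ⟩` — (7.3.2) at `u_k = 1` (both printed forms coincide, `v = 1`)
  with `γ = min(a/(8d), Nc²/(2n²))`, `M = 0`; at the physical normalization `c² = η^{d−2} = n²/N` (so that `‖Dlin c uφ‖² = ‖D_uφ‖²_η =
  Σ_bη^d|η^{−1}(u_bφ(b₊) − φ(b₋))|²` and the unit-lattice norms are the counting ones, (2.2)) the constant is `γ = min(a/(8d), ½)`,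
  uniform in `k` and in the volume (`ineq732_flat_phys`, with the printed `a_k`: `γ = min(a/(9d), ½)` using `a_k ≥ a(1 − L^{−2}) ≥ 8a/9`).
  Mechanism: `E(ψ) ≤ 2E(ψ − Q_kφ_k) + 2E(Q_kφ_k) ≤ 8d‖ψ − Q_kφ_k‖² + 2(n²/(Nc²))‖Dφ_k‖² ≤ γ^{−1}⟨ψ, Δ_kψ⟩`.
* §4 **`ineq732_pureGauge`**: the same inequality at every PURE-GAUGE background `u = 1^h` (`h` any `U(1)` gauge transformation of the
  `η`-lattice), with `u_k(b)` := the transport of `u` along the unit bond `b` (`lineIter u k`, = `h(b₋)h(b₊)^{−1}` at the corner points;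
  [BalabanImbrieJaffe1988] (4.4) *"ū_{k,b} = u_k(⟨b₋, b₊⟩)"*) — by the gauge covariance (6.3.2) of the scalar form, gen 3's
  `BIJ85ScalarPropagatorTorusK.inner_deltaOp_gaugeAct`.
* §5 **`claim73_flat`**: r15's `ScalarStabData.Claim73 𝓅 fam` (∃ γ α M, 0 < γ ∧ 0 < α ∧ ∀ i, (7.3.1) → (7.3.2)) HOLDS for the family
  `flatStabData a` of ALL flat-background data — index `FlatIdx d` = (any `Params` of dimension `d`, hence any `L`, any volume; any
  levels `j`, `k ≥ 1` with `j + k ≤ m + K`), the printed coefficient `a_k = BIJ85Sect4Statements.aK a L k`, the physical normalization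
  `cPhys`, `v ≡ 1` (so `|v(∂p) − 1| = 0` and (7.3.1) holds: `hyp731_flat`), `u_k ≡ 1` — with `γ = min(a/(9d), ½)`, `α = 1`, `M = 0`.

RELATION TO [7] (B4).  `Balaban1983to89/B4Prop31Zero` (cell pub-balaban) proves B4's (1.22) at `A = 0` for finite regions `Ω^{(k)} ⊂ ℤ^{d+1}`
with `γ₀ = min(a/(8(d+1) + 2m²), 1/8)` by the same elementary global argument (energy identity + averaging inequality + Jensen); its header
records *"The torus variant is not typed here"*.  This file is that torus variant for the C1 operators (massless, the series' tori, the
`k`-fold covariant average of (2.6)/(4.6.2)), written directly on the carriers of record — nothing of `B4Prop31Zero` is imported or restated.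

HONEST SCOPE.  (7.3.2) is proved ONLY at flat / pure-gauge backgrounds (where (7.3.1) is void and the error term is not needed).  NOTHING
is claimed at a general background `u_k` obeying (7.3.1): there the covariant block-averaging inequality acquires holonomy defects around the
closed contours `Γ^{(k)}_{yx} ∘ ⟨x, x + L^ke_μ⟩ ∘ (Γ^{(k)}_{y′x′})^{−1} ∘ ⟨y′, y⟩` (products of `O(L^{2k})` plaquette variables), whose control
through (7.3.1) and the structure (4.5.4) of `u_k`, together with a `u`-uniform covariant Poincaré bound for the blocks, is the unprinted
*"extension of the proofs of [7]"* (HOME/GAPS.md G-C1-05).  The regularity/decay sentence of Sect. 7.3 for the `Δ_k(u_k)`-propagators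
is not addressed.  The constant `γ` is not optimized.
-/

open scoped RealInnerProductSpace BigOperators
open Finset

namespace Literature.MathematicalPhysics.QuantumFieldTheory.BalabanImbrieJaffe1984to88.BIJ85Ineq732Flat

open Literature.MathematicalPhysics.QuantumFieldTheory.Balaban1983to89
open BIJ88Sect3Statements (U1 toC cfg covD norm_toC toC_one toC_mul)
open BIJ85Sect1Model (HiggsField)
open BIJ88RenormTransf311 (DeltaAx)
open BIJ85BlockAveragesTorus BIJ85BlockAveragesTorusK BIJ85ScalarPropagatorTorus BIJ85ScalarPropagatorTorusK
open BIJ85ScalarForm464 BIJ85Eq461Proof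
open BIJ85BlockAveragingIneq
open GaugeField (gaugeAct)

noncomputable section

variable {P : Params} {j : ℕ}

/-! ## §1 The unit-lattice covariant bond form of (7.3.2) -/

/-- **The right-hand sum of (7.3.2)**, `Σ_{b∈T₁^{(k)}} |u_k(b)φ(b₊) − φ(b₋)|²`, at a unit-lattice bond field `W` (`= u_k(b)` in the
first printed form, `= v_b` in the second) and a unit-lattice scalar field `ψ` (an element of the `ℓ²` space of fields on `T^{(i)}`).
[cite: BalabanImbrieJaffe1985, (7.3.2) p.326] -/
def bondForm {i : ℕ} (W : GaugeField P i U1) (ψ : PiLp 2 (fun _ : Balaban1983to89.Site P i => ℂ)) : ℝ :=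
  ∑ c : PBond P i, ‖toC (W c) * ψ c.tgt - ψ c.src‖ ^ 2

/-- kernel: the bond form is non-negative. [cite: BalabanImbrieJaffe1985, (7.3.2) p.326] -/
theorem bondForm_nonneg {i : ℕ} (W : GaugeField P i U1) (ψ : PiLp 2 (fun _ : Balaban1983to89.Site P i => ℂ)) :
    0 ≤ bondForm W ψ :=
  sum_nonneg fun _ _ => by positivity

/-- kernel: at `W = 1` (flat `u_k`, or `v = 1`: both printed forms) the bond form is `Σ_b |ψ(b₊) − ψ(b₋)|²`.
[cite: BalabanImbrieJaffe1985, (7.3.2) p.326] -/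
theorem bondForm_one {i : ℕ} (ψ : PiLp 2 (fun _ : Balaban1983to89.Site P i => ℂ)) :
    bondForm (1 : GaugeField P i U1) ψ = ∑ c : PBond P i, ‖ψ c.tgt - ψ c.src‖ ^ 2 := by
  refine sum_congr rfl fun c _ => ?_
  rw [show (1 : GaugeField P i U1) c = 1 from rfl, toC_one, one_mul]

/-- `|a + b|² ≤ 2|a|² + 2|b|²`. [folklore] -/
private theorem norm_add_sq_le_two (a b : ℂ) : ‖a + b‖ ^ 2 ≤ 2 * ‖a‖ ^ 2 + 2 * ‖b‖ ^ 2 := by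
  have h1 : ‖a + b‖ ^ 2 ≤ (‖a‖ + ‖b‖) ^ 2 := pow_le_pow_left₀ (norm_nonneg _) (norm_add_le a b) 2
  nlinarith [sq_nonneg (‖a‖ - ‖b‖)]

/-- kernel: `E_W(ψ₁ + ψ₂) ≤ 2E_W(ψ₁) + 2E_W(ψ₂)` (the bond form is a sum of squares of linear expressions). [cite: BalabanImbrieJaffe1985, (7.3.2) p.326] -/
theorem bondForm_add_le {i : ℕ} (W : GaugeField P i U1) (ψ₁ ψ₂ : PiLp 2 (fun _ : Balaban1983to89.Site P i => ℂ)) :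
    bondForm W (ψ₁ + ψ₂) ≤ 2 * bondForm W ψ₁ + 2 * bondForm W ψ₂ := by
  unfold bondForm
  rw [mul_sum, mul_sum, ← sum_add_distrib]
  refine sum_le_sum fun c _ => ?_
  have e : toC (W c) * (ψ₁ + ψ₂) c.tgt - (ψ₁ + ψ₂) c.src
      = (toC (W c) * ψ₁ c.tgt - ψ₁ c.src) + (toC (W c) * ψ₂ c.tgt - ψ₂ c.src) := by
    simp only [PiLp.add_apply]; ring
  rw [e]
  exact norm_add_sq_le_two _ _

/-- `Σ_x |χ(x)|² = ‖χ‖²` in the `ℓ²` space (the counting weight `1` of (2.2) on the unit lattice). [cite: BalabanImbrieJaffe1985, (2.2) p.302] -/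
theorem sum_norm_sq_eq {i : ℕ} (χ : PiLp 2 (fun _ : Balaban1983to89.Site P i => ℂ)) :
    ∑ x : Balaban1983to89.Site P i, ‖χ x‖ ^ 2 = ‖χ‖ ^ 2 := by
  rw [PiLp.norm_sq_eq_of_L2]

/-- kernel: **`E_W(χ) ≤ 4d‖χ‖²`** — `|W(b)χ(b₊) − χ(b₋)|² ≤ 2|χ(b₊)|² + 2|χ(b₋)|²` (`|W(b)| = 1`) and every site of the torus
is the initial point of `d` bonds and the final point of `d` bonds. [cite: BalabanImbrieJaffe1985, (7.3.2) p.326] -/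
theorem bondForm_le {i : ℕ} (W : GaugeField P i U1) (χ : PiLp 2 (fun _ : Balaban1983to89.Site P i => ℂ)) :
    bondForm W χ ≤ 4 * P.d * ‖χ‖ ^ 2 := by
  unfold bondForm
  calc ∑ c : PBond P i, ‖toC (W c) * χ c.tgt - χ c.src‖ ^ 2
      ≤ ∑ c : PBond P i, (2 * ‖χ c.tgt‖ ^ 2 + 2 * ‖χ c.src‖ ^ 2) := by
        refine sum_le_sum fun c _ => ?_
        have h := norm_add_sq_le_two (toC (W c) * χ c.tgt) (-(χ c.src))
        rw [← sub_eq_add_neg, norm_neg, norm_mul, norm_toC, one_mul] at h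
        exact h
    _ = 2 * (∑ x : Balaban1983to89.Site P i, ∑ _μ : Fin P.d, ‖χ (x.shift _μ)‖ ^ 2)
        + 2 * (∑ x : Balaban1983to89.Site P i, ∑ _μ : Fin P.d, ‖χ x‖ ^ 2) := by
        rw [sum_add_distrib, ← mul_sum, ← mul_sum, sum_bond_eq, sum_bond_eq]
        rfl
    _ = 4 * P.d * ‖χ‖ ^ 2 := by
        rw [sum_sum_shift_dir (fun x => ‖χ x‖ ^ 2), sum_sum_dir (fun x => ‖χ x‖ ^ 2), sum_norm_sq_eq]
        ring

/-! ## §2 The flat background in the `ℓ²` bookkeeping: `‖D₁φ‖²`, the block-averaging inequality for `Q_k(1)` -/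

/-- kernel: at the flat background `‖D₁φ‖² = c²Σ_b|φ(b₊) − φ(b₋)|²` (the `η`-lattice kinetic term (4.6.3) of the free field, normalization `c`).
[cite: BalabanImbrieJaffe1985, (4.6.3) p.313] -/
theorem norm_Dlin_one_sq (c : ℝ) (φ : FineSp P j) :
    ‖Dlin c (1 : GaugeField P j U1) φ‖ ^ 2 = c ^ 2 * ∑ b : PBond P j, ‖φ b.tgt - φ b.src‖ ^ 2 := by
  rw [norm_Dlin_sq, mul_sum]
  refine sum_congr rfl fun b _ => ?_
  rw [show (1 : GaugeField P j U1) b = 1 from rfl, toC_one, one_mul, norm_mul, mul_pow, Complex.norm_real,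
    Real.norm_eq_abs, sq_abs]

/-- **The block-averaging inequality for `Q_k(1)` in the `ℓ²` bookkeeping**: `E₁(Q_k(1)φ) ≤ (n²/N)·Σ_b |φ(b₊) − φ(b₋)|²`
(`BIJ85BlockAveragingIneq.sum_norm_qCovK_one_shift_sub_sq_le`). [cite: BalabanImbrieJaffe1985, (7.3.2) p.326] -/
theorem bondForm_qlinK_one_le {k : ℕ} (hk : j + k ≤ P.m + P.K) (φ : FineSp P j) :
    bondForm (1 : GaugeField P (j+k) U1) (QlinK (1 : GaugeField P j U1) k φ)
      ≤ ((P.L : ℝ) ^ k) ^ 2 / (P.L : ℝ) ^ (k * P.d) * ∑ b : PBond P j, ‖φ b.tgt - φ b.src‖ ^ 2 := by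
  rw [bondForm_one, sum_bond_eq]
  exact sum_norm_qCovK_one_shift_sub_sq_le hk (WithLp.ofLp φ)

/-! ## §3 **(7.3.2) AT THE FLAT BACKGROUND**, every level `k`, every torus -/

/-- **(7.3.2) AT THE FLAT BACKGROUND `u_k = 1`, EVERY LEVEL `k`, EVERY TORUS**: for `j + k ≤ m + K`, `a > 0`, `c ≠ 0`, `G` any right
inverse of `D₁^*D₁ + aQ_k^*Q_k` (it exists: `exists_GK`) and every unit-lattice scalar field `ψ`,
`min(a/(8d), Nc²/(2n²))·Σ_{b∈T₁^{(k)}} |ψ(b₊) − ψ(b₋)|² ≤ ⟨ψ, Δ_k(1)ψ⟩`, `n = L^k`, `N = L^{kd}` — verbatim (7.3.2) with `u_k(b) = 1 = v_b`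
(both printed forms), `γ = min(a/(8d), Nc²/(2n²))` and `M = 0`.  Proof: `⟨ψ, Δ_kψ⟩ = a‖Q_kφ_k − ψ‖² + ‖D₁φ_k‖²` (`BIJ85BlockAveragingIneq.inner_deltaOp_eq`);
`E(ψ) ≤ 2E(ψ − Q_kφ_k) + 2E(Q_kφ_k) ≤ 8d‖ψ − Q_kφ_k‖² + 2(n²/(Nc²))‖D₁φ_k‖²` (`bondForm_le`, `bondForm_qlinK_one_le`, `norm_Dlin_one_sq`).
[cite: BalabanImbrieJaffe1985, (7.3.2) p.326] -/
theorem ineq732_flat {k : ℕ} (hk : j + k ≤ P.m + P.K) {c : ℝ} (hc : c ≠ 0) {a : ℝ} (ha : 0 < a)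
    {G : FineSp P j →ₗ[ℝ] FineSp P j}
    (hG : ∀ φ, opT (Dlin c (1 : GaugeField P j U1)) (QlinK (1 : GaugeField P j U1) k) a (G φ) = φ)
    (ψ : CoarseSpK P j k) :
    min (a / (8 * P.d)) ((P.L : ℝ) ^ (k * P.d) * c ^ 2 / (2 * ((P.L : ℝ) ^ k) ^ 2))
        * bondForm (1 : GaugeField P (j+k) U1) ψ
      ≤ ⟪ψ, deltaOp (QlinK (1 : GaugeField P j U1) k) a G ψ⟫ := by
  set φk : FineSp P j := phiCl (QlinK (1 : GaugeField P j U1) k) a G ψ with hφk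
  set X : ℝ := ‖QlinK (1 : GaugeField P j U1) k φk - ψ‖ ^ 2 with hX
  set Y : ℝ := ‖Dlin c (1 : GaugeField P j U1) φk‖ ^ 2 with hY
  set N : ℝ := (P.L : ℝ) ^ (k * P.d) with hN
  set n : ℝ := (P.L : ℝ) ^ k with hn
  set γ : ℝ := min (a / (8 * P.d)) (N * c ^ 2 / (2 * n ^ 2)) with hγ
  have hd : (0 : ℝ) < P.d := Nat.cast_pos.2 P.hd
  have hLpos : (0 : ℝ) < P.L := Nat.cast_pos.2 P.L_pos
  have hNpos : 0 < N := pow_pos hLpos _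
  have hnpos : 0 < n := pow_pos hLpos _
  have hc2 : 0 < c ^ 2 := by positivity
  have hX0 : 0 ≤ X := by positivity
  have hY0 : 0 ≤ Y := by positivity
  have hE0 := bondForm_nonneg (1 : GaugeField P (j+k) U1) ψ
  have hγ0 : 0 ≤ γ := le_min (by positivity) (by positivity)
  -- the value of the form
  have hΔ : ⟪ψ, deltaOp (QlinK (1 : GaugeField P j U1) k) a G ψ⟫ = a * X + Y := inner_deltaOp_eq hG ψ
  -- E(ψ) ≤ 2E(ψ − Q_kφ_k) + 2E(Q_kφ_k)
  have hsplit : bondForm (1 : GaugeField P (j+k) U1) ψ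
      ≤ 2 * bondForm (1 : GaugeField P (j+k) U1) (ψ - QlinK 1 k φk) + 2 * bondForm (1 : GaugeField P (j+k) U1) (QlinK 1 k φk) := by
    have h := bondForm_add_le (1 : GaugeField P (j+k) U1) (ψ - QlinK 1 k φk) (QlinK 1 k φk)
    rwa [sub_add_cancel] at h
  -- E(ψ − Q_kφ_k) ≤ 4d‖Q_kφ_k − ψ‖²
  have h1 : bondForm (1 : GaugeField P (j+k) U1) (ψ - QlinK 1 k φk) ≤ 4 * P.d * X := by
    rw [hX, ← norm_neg, neg_sub]
    exact bondForm_le _ _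
  -- E(Q_kφ_k) ≤ (n²/(Nc²))‖Dφ_k‖²
  have h2 : bondForm (1 : GaugeField P (j+k) U1) (QlinK 1 k φk) ≤ n ^ 2 / (N * c ^ 2) * Y := by
    have h := bondForm_qlinK_one_le hk φk
    have hS : ∑ b : PBond P j, ‖φk b.tgt - φk b.src‖ ^ 2 = Y / c ^ 2 := by
      rw [hY, norm_Dlin_one_sq, mul_div_cancel_left₀ _ hc2.ne']
    rw [hS] at h
    calc _ ≤ n ^ 2 / N * (Y / c ^ 2) := h
      _ = n ^ 2 / (N * c ^ 2) * Y := by field_simp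
  -- assemble
  have hγ1 : γ * (8 * P.d) ≤ a := by
    have := min_le_left (a / (8 * P.d)) (N * c ^ 2 / (2 * n ^ 2))
    rwa [le_div_iff₀ (by positivity)] at this
  have hγ2 : γ * (2 * (n ^ 2 / (N * c ^ 2))) ≤ 1 := by
    have h := min_le_right (a / (8 * P.d)) (N * c ^ 2 / (2 * n ^ 2))
    calc γ * (2 * (n ^ 2 / (N * c ^ 2))) ≤ N * c ^ 2 / (2 * n ^ 2) * (2 * (n ^ 2 / (N * c ^ 2))) :=
          mul_le_mul_of_nonneg_right h (by positivity)
      _ = 1 := by field_simp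
  calc γ * bondForm (1 : GaugeField P (j+k) U1) ψ
      ≤ γ * (2 * (4 * P.d * X) + 2 * (n ^ 2 / (N * c ^ 2) * Y)) :=
        mul_le_mul_of_nonneg_left (hsplit.trans (by linarith)) hγ0
    _ = γ * (8 * P.d) * X + γ * (2 * (n ^ 2 / (N * c ^ 2))) * Y := by ring
    _ ≤ a * X + 1 * Y := add_le_add (mul_le_mul_of_nonneg_right hγ1 hX0) (mul_le_mul_of_nonneg_right hγ2 hY0)
    _ = _ := by rw [hΔ, one_mul]

/-! ## §4 (7.3.2) at every PURE-GAUGE background, `u_k(b)` = the transport along the unit bond -/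

/-- kernel: for the pure gauge `u = 1^h` the transport along the unit bond `b` of `T₁^{(k)}` is `h(b₋)h(b₊)^{−1}` (`h` read at the corner
points; gen 3's `lineIter_gaugeAct`; standing range). [cite: BalabanImbrieJaffe1985, (2.7) p.303] -/
theorem toC_lineIter_gaugeAct_one {k : ℕ} (hk : j + k ≤ P.m + P.K) (h : GaugeTransf P j U1) (b : PBond P (j+k)) :
    toC (lineIter (gaugeAct h (1 : GaugeField P j U1)) k b)
      = toC (h (cornerIter k b.src)) * (toC (h (cornerIter k b.tgt)))⁻¹ := by
  rw [lineIter_gaugeAct h 1 k hk, lineIter_one, toC_gaugeAct, show (1 : GaugeField P (j+k) U1) b = 1 from rfl, toC_one,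
    mul_one]

/-- kernel: the covariant bond form at a pure-gauge background of the transformed field `ψ^h = hψ` is the flat bond form of `ψ`:
`Σ_b |h(b₋)h(b₊)^{−1}(hψ)(b₊) − (hψ)(b₋)|² = Σ_b |ψ(b₊) − ψ(b₋)|²` (`|h| = 1`). [cite: BalabanImbrieJaffe1985, (7.3.2) p.326] -/
theorem bondForm_lineIter_gaugeAct_one {k : ℕ} (hk : j + k ≤ P.m + P.K) (h : GaugeTransf P j U1)
    {ψ ψ' : CoarseSpK P j k} (hψ' : ∀ y, ψ' y = toC (h (cornerIter k y)) * ψ y) :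
    bondForm (lineIter (gaugeAct h (1 : GaugeField P j U1)) k) ψ' = bondForm (1 : GaugeField P (j+k) U1) ψ := by
  rw [bondForm_one]
  refine sum_congr rfl fun b _ => ?_
  rw [toC_lineIter_gaugeAct_one hk, hψ', hψ']
  have hz := toC_ne_zero (h (cornerIter k b.tgt))
  rw [show toC (h (cornerIter k b.src)) * (toC (h (cornerIter k b.tgt)))⁻¹ * (toC (h (cornerIter k b.tgt)) * ψ b.tgt)
      - toC (h (cornerIter k b.src)) * ψ b.src = toC (h (cornerIter k b.src)) * (ψ b.tgt - ψ b.src) by field_simp,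
    norm_mul, norm_toC, one_mul]

/-- **(7.3.2), first form, AT EVERY PURE-GAUGE BACKGROUND `u = 1^h`** (`h` any `U(1)` gauge transformation of the `η`-lattice), every
level `k` (`j + k ≤ m + K`), every torus, `a > 0`, `c ≠ 0`, `G′` any right inverse of `D_u^*D_u + aQ_k(u)^*Q_k(u)`: with `u_k(b)` := the
transport of `u` along the unit bond `b` (`lineIter u k`; [BalabanImbrieJaffe1988] (4.4) `ū_{k,b} = u_k(⟨b₋, b₊⟩)`),
`min(a/(8d), Nc²/(2n²))·Σ_{b∈T₁^{(k)}} |u_k(b)ψ′(b₊) − ψ′(b₋)|² ≤ ⟨ψ′, Δ_k(u)ψ′⟩` for every `ψ′` — from `ineq732_flat` at `ψ = h^{−1}ψ′` by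
the gauge covariance (6.3.2) of the scalar form (gen 3's `inner_deltaOp_gaugeAct`). [cite: BalabanImbrieJaffe1985, (7.3.2) p.326] -/
theorem ineq732_pureGauge {k : ℕ} (hk : j + k ≤ P.m + P.K) {c : ℝ} (hc : c ≠ 0) {a : ℝ} (ha : 0 < a)
    (h : GaugeTransf P j U1) {G' : FineSp P j →ₗ[ℝ] FineSp P j}
    (hG' : ∀ φ, opT (Dlin c (gaugeAct h (1 : GaugeField P j U1))) (QlinK (gaugeAct h (1 : GaugeField P j U1)) k) a (G' φ) = φ)
    (ψ' : CoarseSpK P j k) :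
    min (a / (8 * P.d)) ((P.L : ℝ) ^ (k * P.d) * c ^ 2 / (2 * ((P.L : ℝ) ^ k) ^ 2))
        * bondForm (lineIter (gaugeAct h (1 : GaugeField P j U1)) k) ψ'
      ≤ ⟪ψ', deltaOp (QlinK (gaugeAct h (1 : GaugeField P j U1)) k) a G' ψ'⟫ := by
  obtain ⟨G, hG, -⟩ := exists_GK hk hc ha (1 : GaugeField P j U1)
  set ψ : CoarseSpK P j k := WithLp.toLp 2 fun y => (toC (h (cornerIter k y)))⁻¹ * ψ' y with hψ
  have hψ' : ∀ y, ψ' y = toC (h (cornerIter k y)) * ψ y := fun y => by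
    rw [hψ, PiLp.toLp_apply, mul_inv_cancel_left₀ (toC_ne_zero _)]
  rw [bondForm_lineIter_gaugeAct_one hk h hψ', inner_deltaOp_gaugeAct hk c ha.le h 1 hG hG' hψ']
  exact ineq732_flat hk hc ha hG ψ

/-! ## §5 Uniform constants: the physical normalization, and `Claim73` for the flat family -/

/-- The PHYSICAL normalization of the `η`-lattice covariant derivative in the `ℓ²`-space bookkeeping of gens 2–3: `c² = η^{d−2} = n²/N`
(`η = L^{−k} = n^{−1}`, `N = n^d`), so that `‖Dlin c uφ‖² = Σ_b η^d|η^{−1}(u_bφ(b₊) − φ(b₋))|² = ‖D_uφ‖²_η` in the weighted norm (2.2) while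
the unit-lattice norms are the counting ones. [cite: BalabanImbrieJaffe1985, (2.2) p.302] -/
def cPhys (P : Params) (k : ℕ) : ℝ := Real.sqrt (((P.L : ℝ) ^ k) ^ 2 / (P.L : ℝ) ^ (k * P.d))

/-- kernel: `cPhys² = n²/N`. [cite: BalabanImbrieJaffe1985, (2.2) p.302] -/
theorem cPhys_sq (P : Params) (k : ℕ) : cPhys P k ^ 2 = ((P.L : ℝ) ^ k) ^ 2 / (P.L : ℝ) ^ (k * P.d) :=
  Real.sq_sqrt (by positivity)

/-- kernel: `cPhys > 0`. [cite: BalabanImbrieJaffe1985, (2.2) p.302] -/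
theorem cPhys_pos (P : Params) (k : ℕ) : 0 < cPhys P k :=
  Real.sqrt_pos.2 (div_pos (pow_pos (pow_pos (Nat.cast_pos.2 P.L_pos) _) _) (pow_pos (Nat.cast_pos.2 P.L_pos) _))

/-- kernel: at the physical normalization the geometric constant of `ineq732_flat` is `Nc²/(2n²) = ½`. [cite: BalabanImbrieJaffe1985, (7.3.2) p.326] -/
theorem cPhys_const (P : Params) (k : ℕ) :
    (P.L : ℝ) ^ (k * P.d) * cPhys P k ^ 2 / (2 * ((P.L : ℝ) ^ k) ^ 2) = 1 / 2 := by
  have h1 : (0 : ℝ) < (P.L : ℝ) ^ (k * P.d) := pow_pos (Nat.cast_pos.2 P.L_pos) _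
  have h2 : (0 : ℝ) < ((P.L : ℝ) ^ k) ^ 2 := pow_pos (pow_pos (Nat.cast_pos.2 P.L_pos) _) _
  rw [cPhys_sq, mul_div_assoc', mul_div_cancel_left₀ _ h1.ne', div_eq_iff (by positivity)]
  ring

/-- **(7.3.2) at the flat background with the PRINTED `a_k` and the physical normalization, `γ = min(a/(9d), ½)` UNIFORM IN `k` AND IN
THE VOLUME**: for `1 ≤ k`, `j + k ≤ m + K`, `a > 0` (the constant of the one-step Gaussian), `G` the inverse of (4.6.2) at `u = 1` and
every `ψ`, `min(a/(9d), ½)·Σ_{b∈T₁^{(k)}} |ψ(b₊) − ψ(b₋)|² ≤ ⟨ψ, Δ_k(1)ψ⟩` (`ineq732_flat` + `cPhys_const` + `a_k ≥ 8a/9`).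
[cite: BalabanImbrieJaffe1985, (7.3.2) p.326] -/
theorem ineq732_flat_phys {k : ℕ} (hk1 : 1 ≤ k) (hk : j + k ≤ P.m + P.K) {a : ℝ} (ha : 0 < a)
    {G : FineSp P j →ₗ[ℝ] FineSp P j}
    (hG : ∀ φ, opT (Dlin (cPhys P k) (1 : GaugeField P j U1)) (QlinK (1 : GaugeField P j U1) k)
      (BIJ85Sect4Statements.aK a P.L k) (G φ) = φ)
    (ψ : CoarseSpK P j k) :
    min (a / (9 * P.d)) (1 / 2) * bondForm (1 : GaugeField P (j+k) U1) ψ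
      ≤ ⟪ψ, deltaOp (QlinK (1 : GaugeField P j U1) k) (BIJ85Sect4Statements.aK a P.L k) G ψ⟫ := by
  have hL : (1 : ℝ) < P.L := by linarith [three_le_L P]
  have haK := (BIJ85CoefficientAk464.aK_pos_le ha hL hk1).1
  have h := ineq732_flat hk (cPhys_pos P k).ne' haK hG ψ
  rw [cPhys_const] at h
  refine le_trans (mul_le_mul_of_nonneg_right ?_ (bondForm_nonneg _ _)) h
  have hd : (0 : ℝ) < P.d := Nat.cast_pos.2 P.hd
  refine min_le_min ?_ le_rfl
  rw [div_le_div_iff₀ (by positivity) (by positivity)]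
  nlinarith [aK_ge_eight_ninths P ha.le hk1]

/-- Index of the FLAT FAMILY of Sect. 7.3 data: any parameters `P` of the series with dimension `d` (any block size `L`, any volume
`L^m`, any number of steps `K`), any `η`-lattice level `j` and any `k ≥ 1` with the unit lattice `T₁^{(k)} = T^{(j+k)}` in the standing
range. [cite: BalabanImbrieJaffe1985, (7.3.2) p.326] -/
structure FlatIdx (d : ℕ) where
  P : Params
  hd : P.d = d
  j : ℕ
  k : ℕ
  hk1 : 1 ≤ k
  hk : j + k ≤ P.m + P.K

/-- kernel: the printed `a_k > 0` at an index (`L ≥ 3`, `k ≥ 1`; gen 2's `aK_pos_le`). [cite: BalabanImbrieJaffe1985, (4.6.4) p.313] -/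
theorem FlatIdx.aK_pos {d : ℕ} (i : FlatIdx d) {a : ℝ} (ha : 0 < a) : 0 < BIJ85Sect4Statements.aK a i.P.L i.k :=
  (BIJ85CoefficientAk464.aK_pos_le ha (by linarith [three_le_L i.P]) i.hk1).1

/-- `G_k(1) = [−Δ + a_kQ_k^*Q_k]^{−1}` at an index of the flat family: THE inverse of (4.6.2) at `u = 1` (it exists and is two-sided,
gen 3's `exists_GK`; chosen by `Classical.choose` — the theorems hold for any right inverse). [cite: BalabanImbrieJaffe1985, (4.6.2) p.313] -/
def flatG {d : ℕ} (a : ℝ) (ha : 0 < a) (i : FlatIdx d) : FineSp i.P i.j →ₗ[ℝ] FineSp i.P i.j :=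
  Classical.choose (exists_GK i.hk (cPhys_pos i.P i.k).ne' (i.aK_pos ha) (1 : GaugeField i.P i.j U1))

/-- kernel: `flatG` is a right inverse of `D₁^*D₁ + a_kQ_k^*Q_k`. [cite: BalabanImbrieJaffe1985, (4.6.2) p.313] -/
theorem flatG_spec {d : ℕ} (a : ℝ) (ha : 0 < a) (i : FlatIdx d) (φ : FineSp i.P i.j) :
    opT (Dlin (cPhys i.P i.k) (1 : GaugeField i.P i.j U1)) (QlinK (1 : GaugeField i.P i.j U1) i.k)
      (BIJ85Sect4Statements.aK a i.P.L i.k) (flatG a ha i φ) = φ :=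
  (Classical.choose_spec (exists_GK i.hk (cPhys_pos i.P i.k).ne' (i.aK_pos ha) (1 : GaugeField i.P i.j U1))).1 φ

/-- **The flat-background MODEL INSTANCE of r15's Sect. 7.3 carrier** `BIJ85Sect7Statements.ScalarStabData` at an index `i`: plaquettes,
bonds, sites of `T₁^{(k)} = Site P (j+k)`; scalar fields `ψ ∈ ℓ²(T₁^{(k)})`; `v ≡ 1` so `|v(∂p) − 1| = 0`; `u_k ≡ 1` so the covariant bond
term is `|ψ(b₊) − ψ(b₋)|²`; `|ψ(x)|²`; the form `⟨ψ, Δ_k(1)ψ⟩` of (4.6.4) with the printed `a_k` and `G_k(1) = flatG`; `e_k` recorded as `1`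
(it enters (7.3.2) only through the `M`-term, which is `0` below, and (7.3.1), which is void at `v = 1`). [cite: BalabanImbrieJaffe1985, (7.3.2) p.326] -/
def flatStabData {d : ℕ} (a : ℝ) (ha : 0 < a) (i : FlatIdx d) : BIJ85Sect7Statements.ScalarStabData where
  Plaq := Balaban1983to89.Plaq i.P (i.j + i.k)
  Bond := PBond i.P (i.j + i.k)
  Site := Balaban1983to89.Site i.P (i.j + i.k)
  Scalar := CoarseSpK i.P i.j i.k
  ek := 1
  plaqDev := fun _ => 0
  covDiffSq := fun ψ b => ‖ψ b.tgt - ψ b.src‖ ^ 2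
  absSq := fun ψ x => ‖ψ x‖ ^ 2
  deltaForm := fun ψ =>
    ⟪ψ, deltaOp (QlinK (1 : GaugeField i.P i.j U1) i.k) (BIJ85Sect4Statements.aK a i.P.L i.k) (flatG a ha i) ψ⟫

/-- kernel: the flat data satisfy the hypothesis (7.3.1) (`0 ≤ e_k(1 + ln e_k^{−1})^𝓅` at `e_k = 1`) — the instance below is not
vacuous on the hypothesis side. [cite: BalabanImbrieJaffe1985, (7.3.1) p.326] -/
theorem hyp731_flat {d : ℕ} (a : ℝ) (ha : 0 < a) (i : FlatIdx d) (pexp : ℝ) : (flatStabData a ha i).Hyp731 pexp := by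
  intro p
  show (0 : ℝ) ≤ 1 * (1 + Real.log 1⁻¹) ^ pexp
  rw [inv_one, Real.log_one, add_zero, Real.one_rpow, mul_one]
  exact zero_le_one

/-- **r15's typed (7.3.2) `ScalarStabData.Ineq732 γ α M` HOLDS for every flat datum** with `γ = min(a/(9d), ½)`, `α = 1`, `M = 0`
(`ineq732_flat_phys`). [cite: BalabanImbrieJaffe1985, (7.3.2) p.326] -/
theorem ineq732_flatStabData {d : ℕ} (a : ℝ) (ha : 0 < a) (i : FlatIdx d) :
    (flatStabData a ha i).Ineq732 (min (a / (9 * d)) (1 / 2)) 1 0 := by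
  intro ψ
  dsimp only [flatStabData] at ψ ⊢
  have hd' : (d : ℝ) = (i.P.d : ℝ) := by rw [i.hd]
  rw [zero_mul, zero_mul, sub_zero, hd']
  have h := ineq732_flat_phys i.hk1 i.hk ha (flatG_spec a ha i) ψ
  rw [bondForm_one] at h
  exact h

/-- **r15's typed claim of Sect. 7.3, `ScalarStabData.Claim73 𝓅 fam` — "for constants γ > 0, α > 0, M < ∞ (chosen before k and the
configuration), (7.3.1) ⇒ (7.3.2)" — PROVED FOR THE FLAT FAMILY** `flatStabData a` over `FlatIdx d` (`d ≥ 1`, `a > 0`, any exponent `𝓅`):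
`γ = min(a/(9d), ½)`, `α = 1`, `M = 0`, uniform in `k`, `L`, the volume and the levels.  HONEST SCOPE: flat backgrounds only; the general
background under (7.3.1) is the paper's unprinted *"extension of the proofs of [7]"*. [cite: BalabanImbrieJaffe1985, (7.3.1)–(7.3.2) p.326] -/
theorem claim73_flat {d : ℕ} (hd : 0 < d) (a : ℝ) (ha : 0 < a) (pexp : ℝ) :
    BIJ85Sect7Statements.ScalarStabData.Claim73 pexp (flatStabData (d := d) a ha) :=
  ⟨min (a / (9 * d)) (1 / 2), 1, 0, lt_min (by positivity) (by norm_num), one_pos,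
    fun i _ => ineq732_flatStabData a ha i⟩

end

end Literature.MathematicalPhysics.QuantumFieldTheory.BalabanImbrieJaffe1984to88.BIJ85Ineq732Flat
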